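import Summits.BirchSwinnertonDyer.BirchSwinnertonDyer.Theorems.PrintCf2SplitBadTwoLocSurjWstar
import Summits.BirchSwinnertonDyer.BirchSwinnertonDyer.Theorems.PrintCf2SplitBadTwoRestrictedSelmerBaseLiftOfLocSurj
import HarnessLib

/-!
# Crux `PrintCf2.SplitBadTwoRankOneOfFacts` (stmt-BirchSwinnertonDyer-20368), road α v10.3 — S3c residual (R-TOP) = brick B17 ASSEMBLED:
# `#𝔖_Γ = 1` on every S3c frame from the three cited Poitou–Tate / cd facts, the CONJUGATE-SUMMAND finiteness inputs, and a local torsion bound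

Cell `bsd-print-cf2`, EXTRA WIDTH seat `bsd-line-cf2-p1-w4` g9 (prover-bsd-line-cf2-p1-w4-g9-0); `--supports stmt-BirchSwinnertonDyer-20368`
(helper, Theses-free). HONEST FRAMING: nothing here closes the crux or a registered stub; BSD is not proved by any of this; no summit statement
is proved by this seat. No definition, no named fact, no `sorry`. CONDITIONAL on the cited facts `poitouTate_sha_tateDual K`,
`poitouTate_selmerStructure_duality K`, `fieldCdLE_two_of_numberField` (the X11b route's standing hypotheses) and on the displayed inputs below.

WHAT. **`natCard_endCoinvariants_eq_one_of_frame_of_conjFiniteness`** = hypothesis (R-TOP) of LEAD g12's `restrictedControl_two_of_residuals`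
(p664178) on every S3c frame carrying a finitely generated dual datum with `HasCharValuationAt n`, GRANTED, besides the three cited facts and
`[W.IsGloballyMinimal]`:
 * hfinB′ — `𝔖_v(K, W*′)` finite, `W*′ = E[𝔮_{1−r}^∞]` (the conjugate frame's bottom finiteness; for (α), p667090);
 * hfinR′ — for every equivariant projector `e′` onto `W*′` and its endomorphism `j′ = ι′e′` of `E[2^∞]`, the `E[𝔮̄^∞]`-parts
   `H¹(j′)(H¹_{𝓛^{ac,R}_v}(K, E[2^∞]))` of Castella's relaxed conjugate groups are finite for all finite `R` away from `2` (for (LS), p671390/6b;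
   = hfinB′ relaxed on `R` plus local finiteness — to be discharged by the conjugate lane);
 * hfix — a bound `2^m` on `E[2^∞]^{Γ_{K_v}}` (finite local torsion at `v`).
Chain: p669287 + p669646 + p670877 + p671390 + `locSurj_of_proj` ⟹ (LS); p668156 ⟹ (β); p665985 + p667090 ⟹ (α); p663870 + p657357 ⟹ `#𝔖_Γ = 1`.
presearch: none new (assembly). beyond-print theorem: no.

References: [JetchevSkinnerWan2017] Lemma 3.3.3, Prop. 3.3.2; [GreenbergLNM1716] §4 Props. 4.13–4.15; [Agboola2007] §5 Prop. 5.1.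
-/

noncomputable section

open scoped Classical

set_option linter.dupNamespace false
set_option autoImplicit false

open CategoryTheory NumberField IsDedekindDomain Field WeierstrassCurve
open Literature.NumberTheory.EllipticCurves Literature.NumberTheory.EllipticCurves.GreenbergSelmer
open Literature.NumberTheory.EllipticCurves.Agboola2007
open Literature.NumberTheory.EllipticCurves.IwasawaAlgebra
open Literature.NumberTheory.EllipticCurves.IwasawaDual
open Literature.NumberTheory.GaloisRepresentations
open Literature.NumberTheory.GaloisCohomology
open scoped ContRepresentation
open Summit.BirchSwinnertonDyer.Rank1Residual.X11b
open Summit.BirchSwinnertonDyer.Rank1Residual.X11b.LocBridge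
open Summit.BirchSwinnertonDyer.Rank1Residual.X11b.AcSelmer
open Summit.BirchSwinnertonDyer.BirchSwinnertonDyer.Theorems.PrintCf2.AdditiveAtSeven
open Summit.BirchSwinnertonDyer.BirchSwinnertonDyer.Theorems.PrintCf2.LevelEigen

namespace Summit.BirchSwinnertonDyer.BirchSwinnertonDyer.Theorems.PrintCf2.RestrictedSelmerPair

variable {K : Type} [Field K] [NumberField K]

/-- **(R-TOP) of `restrictedControl_two_of_residuals` (p664178) ASSEMBLED**: on every S3c frame with a finitely generated dual datum and
`HasCharValuationAt n`, `#𝔖_Γ = 1` — GRANTED the three cited facts, `[W.IsGloballyMinimal]`, the conjugate-summand finiteness inputs hfinB′ and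
hfinR′, and the local torsion bound hfix at `v` (module docstring). [cite: Agboola2007, §5 Prop. 5.1] [cite: JetchevSkinnerWan2017, Lemma 3.3.3 and Prop. 3.3.2]
[cite: GreenbergLNM1716, §4 Props. 4.13–4.15] -/
theorem natCard_endCoinvariants_eq_one_of_frame_of_conjFiniteness {d : ℤ} (hd0 : d ≠ 0) (W : WeierstrassCurve ℚ) [W.IsElliptic]
    [W.IsGloballyMinimal] (C : VariableChange ℚ) (hC : C • W = cm7.quadraticTwist (d : ℚ)) (hK : IsImaginaryQuadratic K)
    (v vbar : HeightOneSpectrum (𝓞 K)) (hv : ((2 : ℕ) : 𝓞 K) ∈ v.asIdeal) (hvbar : ((2 : ℕ) : 𝓞 K) ∈ vbar.asIdeal) (hne : vbar ≠ v)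
    (π : (W.baseChange K).endRing) (hrel : (π : AddMonoid.End (W.baseChange K).geomPoints) * π = π - 2) {r : ℤ_[2]} (hr : r * r = r - 2)
    (κ' : ZpExtension K 2) (hκ' : κ'.IsUnramifiedOutside vbar) {γ' : absoluteGaloisGroup K} (hγ' : κ'.IsTopGenerator γ')
    (D : RestrictedDualData κ' ↥((W.baseChange K).endEigenPrimaryTorsion 2 π r) vbar γ') {n : ℕ}
    (hDf : Module.Finite (IwasawaAlgebra 2) D.X) (hDn : D.HasCharValuationAt n)
    (hPT : poitouTate_sha_tateDual K) (hPTs : poitouTate_selmerStructure_duality K) (hcd : fieldCdLE_two_of_numberField)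
    (hfin' : Finite (restrictedSelmerBase ↥((W.baseChange K).endEigenPrimaryTorsion 2 π (1 - r)) 2 v))
    (hfinR' : ∀ (e' : (W.baseChange K).geomPrimaryTorsion 2 →+ ↥((W.baseChange K).endEigenPrimaryTorsion 2 π (1 - r)))
      (j' : (primaryGaloisModule (W.baseChange K) 2).toContRepresentation →ⁱL (primaryGaloisModule (W.baseChange K) 2).toContRepresentation),
      (∀ x, j' x = (e' x : (W.baseChange K).geomPrimaryTorsion 2)) →
      ∀ R : Set (HeightOneSpectrum (𝓞 K)), R.Finite → (∀ w ∈ R, ((2 : ℕ) : 𝓞 K) ∉ w.asIdeal) →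
        Finite (((acStructure (primaryGaloisModule (W.baseChange K) 2) 2 v R).selmerGroup).map (galoisCohomology.map j' 1)))
    (hfix : ∃ m : ℕ, ∀ Q : (W.baseChange K).geomPrimaryTorsion 2,
      (∀ σ : absoluteGaloisGroup (v.adicCompletion K),
        GaloisRep.restrictField (v.adicCompletion K) (primaryGaloisModule (W.baseChange K) 2) σ Q = Q) → 2 ^ m • Q = 0) :
    Nat.card (EndCoinvariants
      (conjRestricted κ' ↥((W.baseChange K).endEigenPrimaryTorsion 2 π r) vbar γ' - 1)) = 1 := by
  haveI : Fact (Nat.Prime 2) := ⟨Nat.prime_two⟩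
  haveI : (W.baseChange K).IsElliptic := by rw [baseChange]; infer_instance
  haveI : IsTotallyComplex K := hK.2
  have hj : W.j = -3375 := j_eq_of_smul_eq_cm7Twist hd0 W C hC
  obtain ⟨θ, hθ⟩ := exists_sq_eq_neg_seven_of_cmEndo_mem_endRing W K hj π hrel
  have hr' : (1 - r) * (1 - r) = (1 - r) - 2 := by linear_combination hr
  obtain ⟨e, he₁, he₂, hesub, he⟩ := exists_eigenProjector_two W hj K hθ π hrel hr
  obtain ⟨e', he₁', he₂', -, he'⟩ := exists_eigenProjector_two W hj K hθ π hrel hr'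
  rw [sub_sub_cancel] at he₂'
  have hsum : ∀ x, (e x : (W.baseChange K).geomPrimaryTorsion 2) + (e' x : (W.baseChange K).geomPrimaryTorsion 2) = x := by
    intro x
    have h1 : ((e' (x - (e x : (W.baseChange K).geomPrimaryTorsion 2)) : (W.baseChange K).geomPrimaryTorsion 2)) =
        x - (e x : (W.baseChange K).geomPrimaryTorsion 2) := by
      have := he₁' ⟨x - (e x : (W.baseChange K).geomPrimaryTorsion 2), hesub x⟩
      exact congrArg Subtype.val this
    have h2 : e' (e x : (W.baseChange K).geomPrimaryTorsion 2) = 0 := he₂' _ (e x).2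
    have h3 : e' x = e' (x - (e x : (W.baseChange K).geomPrimaryTorsion 2)) + e' (e x : (W.baseChange K).geomPrimaryTorsion 2) := by
      rw [← map_add, sub_add_cancel]
    rw [h3, h2, add_zero, h1, add_sub_cancel]
  -- level cyclicity of `W*` (p669287 §4) and the endomorphism `j' = ι' e'`
  have hcyc : ∀ (N : ℕ) (eN : ((W.baseChange K).torsionGaloisModule ((2 ^ N : ℕ) : ℤ)).toContRepresentation →ⁱL
      ((W.baseChange K).torsionGaloisModule ((2 ^ N : ℕ) : ℤ)).toContRepresentation),
      (∀ x, Levels.primaryInclusion (W.baseChange K) 2 N (eN x) ∈ (W.baseChange K).endEigenPrimaryTorsion 2 π r) →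
        ∃ g : (W.baseChange K).geomTorsion ((2 ^ N : ℕ) : ℤ), ∀ x, ∃ a : ℤ, eN x = a • g :=
    fun N eN heN ↦ exists_forall_levelProj_eq_zsmul W hj K hθ π hrel hr N eN heN
  have hjf' : ∀ (σ : absoluteGaloisGroup K) (x : (W.baseChange K).geomPrimaryTorsion 2),
      (((W.baseChange K).endEigenPrimaryTorsion 2 π (1 - r)).subtype.comp e') (σ • x) =
        σ • (((W.baseChange K).endEigenPrimaryTorsion 2 π (1 - r)).subtype.comp e') x := fun σ x ↦ by
    simp only [AddMonoidHom.comp_apply, AddSubgroup.coe_subtype, he', WeierstrassCurve.endEigenPrimaryTorsion.coe_smul]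
  obtain ⟨j', hj'⟩ := exists_primaryEndo (W.baseChange K) 2 (((W.baseChange K).endEigenPrimaryTorsion 2 π (1 - r)).subtype.comp e') hjf'
  have hj'' : ∀ x, j' x = (e' x : (W.baseChange K).geomPrimaryTorsion 2) := fun x ↦ hj' x
  -- (LS)
  have hLS := locSurj_of_proj (W.baseChange K) 2 π r (1 - r) vbar hPTs e e' he₁ he he₁' he' hsum hcyc j' hj'' hvbar hv hne.symm
    (hfinR' e' j' hj'') hfix
  exact natCard_endCoinvariants_eq_one_of_frame_of_locSurj hd0 W C hC hK v vbar hvbar π hrel hr κ' hκ' hγ' D hDf hDn hPT hcd hfin'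
    (fun S hS τ ↦ hLS S hS τ)

end Summit.BirchSwinnertonDyer.BirchSwinnertonDyer.Theorems.PrintCf2.RestrictedSelmerPair

end
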